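import Summits.Ventures.CertifiedManyBodySolver.Theses.CovLa214M2b
import HarnessLib

/-!
# Route CovLa214M2b — the ASSEMBLY item (stmt-Ventures-26185): `SegmentFanCeiling → TransportFanCeiling → La214M2b_StiffnessBoxCeiling`

Venture CertifiedManyBodySolver, route «CovLa214M2b» (route pen hubbard-m2-certneg-1, Theses/CovLa214M2b.lean rev 0, 2026-08-28T06:25:10Z); seat
`hubbard-cov-la214-unc-2` (`prover-hubbard-cov-la214-unc-2-0`, D-0154 (1)(C) COVERAGE, La214). The assembly is the route's own deciding theorem `closes`
curried: the two APEX-FAN shadows of the station `U_A = 29/5` (segment fan: station source inside `[−3/10, −1/5]`; transport fan: source at or left of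
`−3/10`) cover the La214-E box by `le_total`, and `La214M2b_StiffnessBoxCeiling_of_laBoxE_leaf le_rfl` turns the cell word at the bar `0.4364687` into
the rung leaf. Candidate term attached to the item by the referee hubbard-cov-la214-ref-1 (evidence W3a.lean P2, 2026-08-28T06:49Z) — credited, landed
verbatim in shape.

HONEST FRAMING: glue only — the Assembly is CONDITIONAL on `SegmentFanCeiling ∧ TransportFanCeiling` by construction (both cruxes OPEN); no rung leaf is
proved here, no number, no certificate; a stiffness CEILING on a downfolded box is CONTROL/CALIBRATION + labelled heuristic, silent on `ρ_s = 0`; no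
phase sentence; no summit statement is proved by this seat.
-/

namespace Summit.Ventures.CertifiedManyBodySolver.Theorems

open Summit.Ventures.CertifiedManyBodySolver.Theses.CovLa214M2b

/-- **Assembly of route CovLa214M2b** (item stmt-Ventures-26185): the segment-fan ceiling and the transport-fan ceiling of the apex station `29/5`
together give the MO-S2 rung leaf `La214M2b_StiffnessBoxCeiling` — by the route's deciding theorem `closes` (`le_total (−3/10) (t′(2 − (29/5)/U))` +
`La214M2b_StiffnessBoxCeiling_of_laBoxE_leaf le_rfl`). [cite: KomaTasaki1994, §1] [cite: ScalapinoWhiteZhang1993, §II] -/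
theorem covLa214M2bAssembly_proof : Summit.Ventures.CertifiedManyBodySolver.Theses.CovLa214M2b.Assembly :=
  fun h₁ h₂ => closes h₁ h₂

end Summit.Ventures.CertifiedManyBodySolver.Theorems
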